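import Summits.Parity.GeneralizedHardyLittlewood.Theorems.LiouvilleMADEngineToGHLPairsReach

/-!
# Route LiouvilleMAD — crux `EngineToGHL` (stmt-Parity-14995), line `tuple_ladder` (cycle 2):
# stub `stub_hlTuplesUniform`

The Hardy–Littlewood prime-tuples asymptotic in `Λ`-form, given for EACH finite `H ⊆ ℕ` with
`0 ∈ H`, `#H ≥ 2` as an `=o[atTop]` statement
`S_H(N) := ∑_{n ≤ N} ∏_{h ∈ H} Λ(n + h) = 𝔖(H↑) N + o(N)`, is made UNIFORM over the finitely many
such `H` inside `[0, Hb]`: for every `δ > 0` one constant `C ≥ 0` with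
`|S_H(M) - 𝔖(H↑) M| ≤ δ M + C` for ALL `M` and all those `H`.

Proof: per `H`, `EngineToGHL.abs_sub_le_linear_of_isLittleO` turns `o(N)` into `δ M + C_H`; the
admissible `H` are members of the finite family `(range (Hb + 1)).powerset`, and `C := ∑ C_H` over
that family dominates each `C_H` (`Finset.single_le_sum`).  This is the general-`t` version of
`EngineToGHL.pairsHL_uniform_bound`.

References: G. H. Hardy, J. E. Littlewood, Acta Math. 44 (1923) [HardyLittlewood1923].
-/

noncomputable section

namespace Summit.Parity.GeneralizedHardyLittlewood.Theorems.EngineToGHL.TupleLadder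

open Finset Filter Literature.NumberTheory.Sieve
open scoped ArithmeticFunction.vonMangoldt

/-- Hardy–Littlewood for tuples, made uniform: if for every finite `H ∋ 0` with `#H ≥ 2` one has
`∑_{n ≤ N} ∏_{h ∈ H} Λ(n+h) - 𝔖(H↑) N = o(N)`, then for every `Hb` and `δ > 0` there is ONE
`C ≥ 0` with `|∑_{n ≤ M} ∏_{h ∈ H} Λ(n+h) - 𝔖(H↑) M| ≤ δ M + C` for all `M` and all such
`H ⊆ [0, Hb]`. [folklore] -/
theorem stub_hlTuplesUniform : (∀ H : Finset ℕ, 0 ∈ H → 2 ≤ H.card → ((fun N : ℕ => ∑ n ∈ Finset.Icc 1 N, ∏ h ∈ H, ArithmeticFunction.vonMangoldt (n + h) - Literature.NumberTheory.Sieve.singularSeries ((H).image (fun h : ℕ => (h : ℤ))) * N) =o[Filter.atTop] fun N : ℕ => (N : ℝ))) → (∀ (Hb : ℕ) (δ : ℝ), 0 < δ → ∃ C : ℝ, 0 ≤ C ∧ ∀ H : Finset ℕ, 0 ∈ H → 2 ≤ H.card → (∀ h ∈ H, h ≤ Hb) → ∀ M : ℕ, |∑ n ∈ Finset.Icc 1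 M, ∏ h ∈ H, ArithmeticFunction.vonMangoldt (n + h) - Literature.NumberTheory.Sieve.singularSeries ((H).image (fun h : ℕ => (h : ℤ))) * M| ≤ δ * M + C) := by
  intro hP Hb δ hδ
  -- per-`H` constants (`0` for the inadmissible `H`)
  have key : ∀ H : Finset ℕ, ∃ C : ℝ, 0 ≤ C ∧ (0 ∈ H → 2 ≤ H.card → ∀ M : ℕ,
      |∑ n ∈ Icc 1 M, ∏ h ∈ H, Λ (n + h) - singularSeries (H.image (fun h : ℕ => (h : ℤ))) * M| ≤
        δ * M + C) := by
    intro H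
    by_cases h0 : 0 ∈ H
    · by_cases h2 : 2 ≤ H.card
      · obtain ⟨C, hC0, hC⟩ := abs_sub_le_linear_of_isLittleO
          (f := fun M : ℕ => ∑ n ∈ Icc 1 M, ∏ h ∈ H, Λ (n + h)) (hP H h0 h2) hδ
        exact ⟨C, hC0, fun _ _ => hC⟩
      · exact ⟨0, le_rfl, fun _ h' => absurd h' h2⟩
    · exact ⟨0, le_rfl, fun h' => absurd h' h0⟩
  choose C hC0 hC using key
  -- one constant for the whole finite family `H ⊆ [0, Hb]`: the sum of the per-`H` constants
  refine ⟨∑ H ∈ (range (Hb + 1)).powerset, C H, Finset.sum_nonneg fun H _ => hC0 H,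
    fun H h0 h2 hHb M => ?_⟩
  have hmem : H ∈ (range (Hb + 1)).powerset := by
    rw [mem_powerset]
    intro h hh
    exact mem_range.mpr (Nat.lt_succ_of_le (hHb h hh))
  have hle : C H ≤ ∑ H ∈ (range (Hb + 1)).powerset, C H :=
    Finset.single_le_sum (fun H _ => hC0 H) hmem
  exact (hC H h0 h2 M).trans (by linarith)

end Summit.Parity.GeneralizedHardyLittlewood.Theorems.EngineToGHL.TupleLadder

end
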